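import Literature.NumberTheory.GaloisRepresentations.LubinTateColemanDerivative
import Literature.NumberTheory.GaloisRepresentations.LubinTateColemanNorm
import HarnessLib

/-!
# The invariant differential of a Lubin–Tate formal group and the translation / `[a]`-equivariance
of the invariant derivation

De Shalit, *Iwasawa theory of elliptic curves with complex multiplication* (1987), Ch. I §3.5:
`D = (1/λ'(X)) d/dX` is the translation-invariant derivation of `F_f`; in §3.12 and in Wiles' explicit
reciprocity law (I §4.2) Coleman's logarithmic derivative `δg = (1/λ') g'/g` is built from it.  Here the
unit `1/λ' ∈ 𝒪⟦X⟧ˣ` is introduced WITHOUT the logarithm (whose coefficients are not integral) as the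
**invariant differential** `ω_F(Y) = ∂F/∂X (0, Y)` read off the formal group law `F = F_f(X, Y)`
(`invDiff`, constant term `1`, a unit of `A⟦X⟧`), and its two structural identities are PROVED:

* ★ `LubinTate.transl_invDiff` — **translation invariance**: `ω_F(X [+] ω) = (d/dX (X [+] ω)) · ω_F(X)`
  for every point `ω` (so `D(h(X [+] ω)) = (Dh)(X [+] ω)` for `D = ω_F · d/dX`);
* ★ `LubinTate.map_invDiff_mul_derivative_hom` — **`[a]`-equivariance**: `ω_F · [a]' = a · ω_F ∘ [a]`
  (so `D(h ∘ [a]) = a · (Dh) ∘ [a]`; for `a = π`: `ω_F · f' = π · ω_F ∘ f`).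

Both come from ONE computation (`coeff_one_evT`: the linear coefficient of a composite `G(u)` is
`G'(u₀) · u₁`), applied to the point identities `(X [+] ω') ∘ (X [+] ω) = X [+] (ω [+] ω')` and
`[a](X [+] ω) = [a]X [+] [a]ω` in `S⟦X⟧` and then once more one level up, in `S⟦X⟧⟦Y⟧` with the points
`X` (a constant) and `Y` — the tree's points formalism (`LubinTateColeman.lean`) iterates verbatim.
Also: the chain rule `derivative_evT` for `S`-coefficient evaluation `G ↦ G(u)`, `coeff_one_tPt`
(`X [+] ω ≡ ω + ω_F(ω)·X`), the logarithmic derivative `PowerSeries.dlog` of units and its transport.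
Everything here is proved (0 sorry); typeclass-generic in the coefficient ring `A` and the point algebra `S`.

## References

* E. de Shalit, *Iwasawa theory of elliptic curves with complex multiplication*, Perspectives in
  Math. 3 (1987), Ch. I §3.5 (the invariant derivation), §3.12 (`δg = D log g`), §4.2. [deShalit1987]
* S. Lang, *Cyclotomic Fields I and II*, GTM 121 (1990), Ch. 8 §2 "The logarithmic derivative". [Lang1990]

## Mathlib / tree reuse

`PowerSeries.derivative` (`d⁄dX`), `PowerSeries.hasSum_aeval`, `MvPowerSeries.hasSum_aeval`,
`Function.Injective.hasSum_iff`, `Finsupp.prod_fintype`, `PowerSeries.coeff_C_mul_X_pow`; tree: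
`LubinTateColeman.lean` (`seriesNilIdeal`, `serX`, `serC`, `evalAt`, `evS`, `evT`, `evTPt`, `tPt`, `transl`,
`ccPt`, `evTPt_tPt_tPt`, `evT_map`, `evalAt_serX`, `constantCoeff_evT`, `evS_zero_eq`),
`LubinTateColemanNorm.lean` (`algHom_evalPt`), `LubinTateColemanDerivative.lean`, `LubinTatePoints.lean`
(`ltAdd`, `ltSMul`, `ltSMul_ltAdd`), `LubinTate.lean` (`ltF`, `hom`, `coeff_ltF_single`, `coeff_one_hom`).
-/

noncomputable section

open Filter Topology
open scoped PowerSeries.WithPiTopology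

/-! ### Calculus: linear coefficients, `map`, logarithmic derivatives of units -/

namespace PowerSeries

variable {R : Type*} [CommRing R]

/-- The constant term of `G'` is the linear coefficient of `G` (private copy of a one-liner that
exists in unrelated heavy modules of the tree). [folklore] -/
private theorem constantCoeff_derivative (G : R⟦X⟧) : constantCoeff (d⁄dX R G) = coeff 1 G := by
  rw [← coeff_zero_eq_constantCoeff_apply, coeff_derivative, Nat.cast_zero, zero_add, zero_add, mul_one]

/-- `d⁄dX` commutes with coefficientwise maps (private copy, same reason). [folklore] -/
private theorem derivative_map {T : Type*} [CommRing T] (φ : R →+* T) (G : R⟦X⟧) :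
    d⁄dX T (G.map φ) = (d⁄dX R G).map φ := by
  ext n
  simp only [coeff_derivative, coeff_map, map_mul, map_add, map_natCast, map_one]

/-- **The logarithmic derivative `G'/G` of a unit `G`.** [cite: Lang1990, Ch. 8 §2] -/
def dlog (G : (R⟦X⟧)ˣ) : R⟦X⟧ := d⁄dX R (G : R⟦X⟧) * ↑G⁻¹

/-- Unfolding `dlog`. [cite: deShalit1987, Ch. I §3.5] -/
theorem dlog_def (G : (R⟦X⟧)ˣ) : dlog G = d⁄dX R (G : R⟦X⟧) * ↑G⁻¹ := rfl

/-- `dlog (G H) = dlog G + dlog H`. [cite: Lang1990, Ch. 8 §2] -/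
theorem dlog_mul (G H : (R⟦X⟧)ˣ) : dlog (G * H) = dlog G + dlog H := by
  have hG : (G : R⟦X⟧) * ↑G⁻¹ = 1 := G.mul_inv
  have hH : (H : R⟦X⟧) * ↑H⁻¹ = 1 := H.mul_inv
  rw [dlog, dlog, dlog, Units.val_mul, mul_inv, Units.val_mul, (d⁄dX R).leibniz, smul_eq_mul,
    smul_eq_mul]
  linear_combination (d⁄dX R (H : R⟦X⟧) * ↑H⁻¹) * hG + (d⁄dX R (G : R⟦X⟧) * ↑G⁻¹) * hH

/-- `dlog 1 = 0`. [cite: deShalit1987, Ch. I §3.5] -/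
theorem dlog_one : dlog (1 : (R⟦X⟧)ˣ) = 0 := by
  rw [dlog, Units.val_one, (d⁄dX R).map_one_eq_zero, zero_mul]

/-- `dlog (∏ Gᵢ) = Σ dlog Gᵢ`. [cite: Lang1990, Ch. 8 §2] -/
theorem dlog_prod {ι : Type*} (s : Finset ι) (G : ι → (R⟦X⟧)ˣ) :
    dlog (∏ i ∈ s, G i) = ∑ i ∈ s, dlog (G i) := by
  classical
  induction s using Finset.induction_on with
  | empty => rw [Finset.prod_empty, Finset.sum_empty, dlog_one]
  | insert i s hi ih => rw [Finset.prod_insert hi, Finset.sum_insert hi, dlog_mul, ih]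

/-- `dlog` only depends on the underlying series. [cite: deShalit1987, Ch. I §3.5] -/
theorem dlog_congr {G H : (R⟦X⟧)ˣ} (h : (G : R⟦X⟧) = H) : dlog G = dlog H := by
  rw [Units.ext h]

/-- **Transport of `dlog`** along a ring map `ψ : R⟦X⟧ → T⟦X⟧` satisfying a chain rule
`(ψ G)' = ψ(G') · c`: if `H = ψ G` then `dlog H = ψ (dlog G) · c`. [cite: deShalit1987, Ch. I §3.5] -/
theorem dlog_eq_of_map {T : Type*} [CommRing T] (ψ : R⟦X⟧ →+* T⟦X⟧) (c : T⟦X⟧)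
    (hψ : ∀ G : R⟦X⟧, d⁄dX T (ψ G) = ψ (d⁄dX R G) * c) (G : (R⟦X⟧)ˣ) (H : (T⟦X⟧)ˣ)
    (h : (H : T⟦X⟧) = ψ G) : dlog H = ψ (dlog G) * c := by
  have hinv : (↑H⁻¹ : T⟦X⟧) = ψ ↑G⁻¹ := by
    refine Units.inv_eq_of_mul_eq_one_right ?_
    rw [h, ← map_mul, Units.mul_inv, map_one]
  rw [dlog, dlog, hinv, h, hψ, map_mul]
  ring

/-- `dlog` of a coefficientwise image: `H = ι G ⟹ dlog H = ι (dlog G)`. [cite: deShalit1987, Ch. I §3.5] -/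
theorem dlog_eq_of_map_eq {T : Type*} [CommRing T] (φ : R →+* T) (G : (R⟦X⟧)ˣ) (H : (T⟦X⟧)ˣ)
    (h : (H : T⟦X⟧) = (G : R⟦X⟧).map φ) : dlog H = (dlog G).map φ := by
  have := dlog_eq_of_map (PowerSeries.map φ) 1 (fun G => by rw [mul_one, derivative_map]) G H h
  rw [mul_one] at this
  exact this

/-- `dlog` of a substitution: `H = G ∘ g ⟹ dlog H = (dlog G) ∘ g · g'`. [cite: Lang1990, Ch. 8 §2] -/
theorem dlog_eq_of_subst_eq {g : R⟦X⟧} (hg : HasSubst g) (G H : (R⟦X⟧)ˣ)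
    (h : (H : R⟦X⟧) = (G : R⟦X⟧).subst g) : dlog H = (dlog G).subst g * d⁄dX R g := by
  let ψ : R⟦X⟧ →+* R⟦X⟧ := (substAlgHom hg : R⟦X⟧ →ₐ[R] R⟦X⟧).toRingHom
  have hψ : ∀ G : R⟦X⟧, ψ G = G.subst g := fun G => by
    change substAlgHom hg G = _
    rw [coe_substAlgHom]
  have := dlog_eq_of_map ψ (d⁄dX R g) (fun G => by rw [hψ, hψ, derivative_subst R hg]) G H
    (by rw [hψ, h])
  rw [this, hψ]

end PowerSeries

namespace Literature.NumberTheory.GaloisRepresentations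

namespace LubinTate

/-! ### The invariant differential `ω_F(Y) = ∂F/∂X (0, Y)` -/

section InvDiff

variable {A : Type*} [CommRing A] {π : A} {q : ℕ} (hA : IsLTRing π q) {f : PowerSeries A}
  (hf : IsLTSeries π q f)

/-- **The invariant differential** `ω_F ∈ A⟦X⟧` of the Lubin–Tate formal group `F = F_f`:
`ω_F(Y) = ∂F/∂X (0, Y) = Σᵢ F_{(1,i)} Yⁱ` (the coefficient of `X¹` in `F(X, Y)`).  Over the fraction
field `ω_F = 1/λ_f'`, and `D = ω_F · d/dX` is the invariant derivation of de Shalit I §3.5.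
[cite: deShalit1987, Ch. I §3.5] -/
def invDiff : PowerSeries A :=
  PowerSeries.mk fun i => MvPowerSeries.coeff (Finsupp.single 0 1 + Finsupp.single 1 i) (ltF hA hf)

/-- Coefficients of `ω_F` (unfolding). [cite: deShalit1987, Ch. I §3.5] -/
theorem coeff_invDiff (i : ℕ) :
    PowerSeries.coeff i (invDiff hA hf) =
      MvPowerSeries.coeff (Finsupp.single 0 1 + Finsupp.single 1 i) (ltF hA hf) := by
  rw [invDiff, PowerSeries.coeff_mk]

/-- `ω_F(0) = 1` (as `F ≡ X + Y mod deg 2`). [cite: deShalit1987, Ch. I §3.5] -/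
theorem constantCoeff_invDiff : PowerSeries.constantCoeff (invDiff hA hf) = 1 := by
  rw [← PowerSeries.coeff_zero_eq_constantCoeff_apply, coeff_invDiff, Finsupp.single_zero, add_zero,
    coeff_ltF_single]

/-- `ω_F` is a unit of `A⟦X⟧`. [cite: deShalit1987, Ch. I §3.5] -/
theorem isUnit_invDiff : IsUnit (invDiff hA hf) := by
  rw [PowerSeries.isUnit_iff_constantCoeff, constantCoeff_invDiff]
  exact isUnit_one

end InvDiff

/-! ### Points of `S⟦X⟧`: the chain rule for `G ↦ G(u)` and the linear coefficient of `X [+] ω` -/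

section Points

variable {A : Type*} [CommRing A] [UniformSpace A] [DiscreteUniformity A]
variable {S : Type*} [CommRing S] [UniformSpace S] [IsUniformAddGroup S] [IsTopologicalRing S]
  [IsLinearTopology S S] [T2Space S] [CompleteSpace S] [Algebra A S] [ContinuousSMul A S]
variable (M : NilIdeal S) {π : A} {q : ℕ} (hA : IsLTRing π q) {f : PowerSeries A}
  (hf : IsLTSeries π q f)

omit [UniformSpace A] [DiscreteUniformity A] [Algebra A S] [ContinuousSMul A S] in
/-- **Chain rule for `S`-coefficient evaluation**: `d⁄dX (G(u)) = G'(u) · u'` for `G ∈ S⟦X⟧` and a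
point `u` of `S⟦X⟧`. [cite: deShalit1987, Ch. I §3.5] -/
theorem derivative_evT (u : (seriesNilIdeal M).toIdeal) (G : PowerSeries S) :
    PowerSeries.derivative S (evT M u G) =
      evT M u (PowerSeries.derivative S G) * PowerSeries.derivative S (u : PowerSeries S) := by
  have ht : IsTopologicallyNilpotent (u : PowerSeries S) :=
    (seriesNilIdeal M).isTopologicallyNilpotent _ u.2
  set t : PowerSeries S := (u : PowerSeries S)
  change PowerSeries.derivative S (PowerSeries.aeval ht G) =
    PowerSeries.aeval ht (PowerSeries.derivative S G) * PowerSeries.derivative S t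
  have h1 : HasSum (fun n => PowerSeries.derivative S (PowerSeries.coeff n G • t ^ n))
      (PowerSeries.derivative S (PowerSeries.aeval ht G)) :=
    (PowerSeries.hasSum_aeval ht G).map (PowerSeries.derivative S).toLinearMap.toAddMonoidHom
      PowerSeries.continuous_derivative
  have h2 : HasSum (fun n => (PowerSeries.coeff n (PowerSeries.derivative S G) • t ^ n) *
      PowerSeries.derivative S t)
      (PowerSeries.aeval ht (PowerSeries.derivative S G) * PowerSeries.derivative S t) :=
    (PowerSeries.hasSum_aeval ht (PowerSeries.derivative S G)).mul_right _
  have h3 : (fun n => PowerSeries.derivative S (PowerSeries.coeff (n + 1) G • t ^ (n + 1))) =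
      fun n => (PowerSeries.coeff n (PowerSeries.derivative S G) • t ^ n) *
        PowerSeries.derivative S t := by
    funext n
    rw [PowerSeries.smul_eq_C_mul, PowerSeries.smul_eq_C_mul, (PowerSeries.derivative S).leibniz,
      PowerSeries.derivative_C, smul_zero, add_zero, (PowerSeries.derivative S).leibniz_pow,
      Nat.add_sub_cancel, PowerSeries.coeff_derivative, map_mul, map_add, map_natCast, map_one,
      smul_eq_mul, nsmul_eq_mul, smul_eq_mul]
    push_cast
    ring
  have h0 : PowerSeries.derivative S (PowerSeries.coeff 0 G • t ^ 0) = 0 := by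
    rw [pow_zero, PowerSeries.smul_eq_C_mul, mul_one, PowerSeries.derivative_C]
  have h4 := (hasSum_nat_add_iff' 1).mpr h1
  rw [Finset.sum_range_one, h0, sub_zero, h3] at h4
  exact h4.unique h2

omit [UniformSpace A] [DiscreteUniformity A] [Algebra A S] [ContinuousSMul A S] in
/-- **The linear coefficient of a composite**: `coeff₁ (G(u)) = G'(u₀) · u₁`. [cite: deShalit1987, Ch. I §3.5] -/
theorem coeff_one_evT (u : (seriesNilIdeal M).toIdeal) (G : PowerSeries S) :
    PowerSeries.coeff 1 (evT M u G) =
      evS M (ccPt M u) (PowerSeries.derivative S G) * PowerSeries.coeff 1 (u : PowerSeries S) := by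
  rw [← PowerSeries.constantCoeff_derivative, derivative_evT, map_mul, constantCoeff_evT,
    PowerSeries.constantCoeff_derivative]

/-- The constant coefficient of the point `X [+] ω` is `ω`. [cite: deShalit1987, Ch. I §3.5] -/
theorem constantCoeff_tPt (ω : M.toIdeal) :
    PowerSeries.constantCoeff ((tPt M hA hf ω : (seriesNilIdeal M).toIdeal) : PowerSeries S) = ω := by
  rw [← evS_zero_eq M, ← coe_evSPt, evSPt_tPt, zero_ltAdd]

/-- `ccPt (X [+] ω) = ω` (general point algebras). [cite: deShalit1987, Ch. I §3.5] -/
theorem ccPt_tPt' (ω : M.toIdeal) : ccPt M (tPt M hA hf ω) = ω :=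
  Subtype.ext (constantCoeff_tPt M hA hf ω)

/-- ★ **`X [+] ω ≡ ω + ω_F(ω) · X (mod X²)`**: the linear coefficient of the point `X [+] ω` of `S⟦X⟧`
is the value `ω_F(ω)` of the invariant differential. [cite: deShalit1987, Ch. I §3.5] -/
theorem coeff_one_tPt (ω : M.toIdeal) :
    PowerSeries.coeff 1 ((tPt M hA hf ω : (seriesNilIdeal M).toIdeal) : PowerSeries S) =
      evalAt M ω (invDiff hA hf) := by
  classical
  -- the expansion `F(X, C ω) = Σ_d F_d X^{d 0} (C ω)^{d 1}`
  have hsum := MvPowerSeries.hasSum_aeval ((seriesNilIdeal M).hasEval ![serX M, serC M ω]) (ltF hA hf)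
  have e0 : ((tPt M hA hf ω : (seriesNilIdeal M).toIdeal) : PowerSeries S) =
      MvPowerSeries.aeval ((seriesNilIdeal M).hasEval ![serX M, serC M ω]) (ltF hA hf) := rfl
  have h1 := hsum.map (PowerSeries.coeff (R := S) 1) (PowerSeries.WithPiTopology.continuous_coeff S 1)
  -- the terms: `coeff₁ (F_d • X^{d0} (C ω)^{d1}) = [d 0 = 1] F_d ω^{d 1}`
  have hterm : ∀ d : Fin 2 →₀ ℕ,
      (PowerSeries.coeff (R := S) 1) (MvPowerSeries.coeff d (ltF hA hf) •
        d.prod fun s e => (((![serX M, serC M ω] s : (seriesNilIdeal M).toIdeal) : PowerSeries S)) ^ e) =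
      if d 0 = 1 then algebraMap A S (MvPowerSeries.coeff d (ltF hA hf)) * (ω : S) ^ (d 1) else 0 := by
    intro d
    rw [Finsupp.prod_fintype _ _ (fun i => pow_zero _), Fin.prod_univ_two, Matrix.cons_val_zero,
      Matrix.cons_val_one, Matrix.cons_val_fin_one, coe_serX, coe_serC, ← map_pow, mul_comm,
      PowerSeries.algebra_smul_eq_C_mul, ← mul_assoc, ← map_mul, PowerSeries.coeff_C_mul_X_pow]
    by_cases hd : d 0 = 1
    · rw [if_pos hd, if_pos hd.symm, mul_comm]
    · rw [if_neg hd, if_neg (Ne.symm hd)]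
  have hcomp : (⇑(PowerSeries.coeff (R := S) 1) ∘ fun d : Fin 2 →₀ ℕ => MvPowerSeries.coeff d (ltF hA hf) •
      d.prod fun s e => (((![serX M, serC M ω] s : (seriesNilIdeal M).toIdeal) : PowerSeries S)) ^ e) =
      fun d => if d 0 = 1 then algebraMap A S (MvPowerSeries.coeff d (ltF hA hf)) * (ω : S) ^ (d 1)
        else 0 := funext fun d => hterm d
  rw [hcomp] at h1
  -- the other side: `ω_F(ω) = Σ_i F_{(1,i)} ω^i`
  have h2 : HasSum (fun i : ℕ => PowerSeries.coeff i (invDiff hA hf) • (ω : S) ^ i)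
      (evalAt M ω (invDiff hA hf)) := PowerSeries.hasSum_aeval _ _
  -- re-index along `i ↦ (1, i)`
  let emb : ℕ → (Fin 2 →₀ ℕ) := fun i => Finsupp.single 0 1 + Finsupp.single 1 i
  have hemb0 : ∀ i, emb i 0 = 1 := fun i => by
    simp [emb, Finsupp.add_apply]
  have hemb1 : ∀ i, emb i 1 = i := fun i => by
    simp [emb, Finsupp.add_apply]
  have hinj : Function.Injective emb := fun i j h => by
    have := congrArg (fun d : Fin 2 →₀ ℕ => d 1) h
    simpa [hemb1] using this
  have hzero : ∀ d ∉ Set.range emb,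
      (if d 0 = 1 then algebraMap A S (MvPowerSeries.coeff d (ltF hA hf)) * (ω : S) ^ (d 1) else 0) = 0 := by
    intro d hd
    rw [if_neg]
    intro hd0
    refine hd ⟨d 1, Finsupp.ext fun k => ?_⟩
    fin_cases k
    · exact (hemb0 _).trans hd0.symm
    · exact hemb1 _
  have h3 := (hinj.hasSum_iff hzero).mpr h1
  have h4 : ((fun d : Fin 2 →₀ ℕ => if d 0 = 1 then algebraMap A S (MvPowerSeries.coeff d (ltF hA hf)) *
      (ω : S) ^ (d 1) else 0) ∘ emb) =
      fun i : ℕ => PowerSeries.coeff i (invDiff hA hf) • (ω : S) ^ i := by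
    funext i
    simp only [Function.comp_apply, hemb0, hemb1, if_true, coeff_invDiff, Algebra.smul_def]
    rfl
  rw [h4] at h3
  rw [e0]
  exact h3.unique h2


/-! ### Point forms: translation invariance and `[a]`-equivariance of `ω_F` -/

/-- `(X [+] ω)(t) = t [+] C ω` for a point `t` of `S⟦X⟧`. [cite: deShalit1987, Ch. I §3.5] -/
theorem evTPt_tPt (t : (seriesNilIdeal M).toIdeal) (ω : M.toIdeal) :
    evTPt M t (tPt M hA hf ω) = ltAdd (seriesNilIdeal M) hA hf t (serC M ω) := by
  change evTPt M t (evalPt (seriesNilIdeal M) (formalGroup hA hf).toPowerSeries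
    (formalGroup hA hf).zero_constantCoeff ![serX M, serC M ω]) = _
  rw [evTPt_evalPt, comp_vecCons2, evTPt_serX, evTPt_serC]
  rfl

/-- ★ **Translation invariance at points**: `ω_F(ω [+] ω') = (d⁄dX (X [+] ω'))(ω) · ω_F(ω)`
(differentiate `(X [+] ω') ∘ (X [+] ω) = X [+] (ω [+] ω')` and read off the linear coefficient).
[cite: deShalit1987, Ch. I §3.5] -/
theorem evalAt_ltAdd_invDiff (ω ω' : M.toIdeal) :
    evalAt M (ltAdd M hA hf ω ω') (invDiff hA hf) =
      evS M ω (PowerSeries.derivative S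
        ((tPt M hA hf ω' : (seriesNilIdeal M).toIdeal) : PowerSeries S)) *
        evalAt M ω (invDiff hA hf) := by
  rw [← coeff_one_tPt M hA hf, ← coeff_one_tPt M hA hf, ← evTPt_tPt_tPt, coe_evTPt, coeff_one_evT,
    ccPt_tPt']

/-- The point `[a]X` of `S⟦X⟧` is the series `ι [a]_f`. [cite: deShalit1987, Ch. I §3.5] -/
theorem coe_ltSMul_serX (a : A) :
    ((ltSMul (seriesNilIdeal M) hA hf a (serX M) : (seriesNilIdeal M).toIdeal) : PowerSeries S) =
      (hom hA hf hf a).map (algebraMap A S) := by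
  unfold ltSMul
  rw [coe_evalPt₁_eq_evalAt, evalAt_serX]

/-- ★ **`[a]`-equivariance at points**: `a · ω_F([a]ω) = [a]'(ω) · ω_F(ω)` (differentiate
`[a](X [+] ω) = [a]X [+] [a]ω` and read off the linear coefficient). [cite: deShalit1987, Ch. I §3.5] -/
theorem evalAt_ltSMul_invDiff (a : A) (ω : M.toIdeal) :
    algebraMap A S a * evalAt M (ltSMul M hA hf a ω) (invDiff hA hf) =
      evS M ω (PowerSeries.derivative S ((hom hA hf hf a).map (algebraMap A S))) *
        evalAt M ω (invDiff hA hf) := by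
  -- the point `s = [a]X` of `S⟦X⟧`: constant term `0`, linear term `a`
  set s : (seriesNilIdeal M).toIdeal := ltSMul (seriesNilIdeal M) hA hf a (serX M) with hs_def
  have hs : (s : PowerSeries S) = (hom hA hf hf a).map (algebraMap A S) := coe_ltSMul_serX M hA hf a
  have hs0 : ccPt M s = 0 := by
    apply Subtype.ext
    rw [coe_ccPt, hs, constantCoeff_map_eq_zero _ (constantCoeff_hom hA hf hf a)]
    rfl
  have hs1 : PowerSeries.coeff 1 (s : PowerSeries S) = algebraMap A S a := by
    rw [hs, PowerSeries.coeff_map, coeff_one_hom]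
  -- `[a](X [+] ω) = ([a]X)` composed with `X [+] [a]ω`
  have key : evTPt M s (tPt M hA hf (ltSMul M hA hf a ω)) =
      ltSMul (seriesNilIdeal M) hA hf a (tPt M hA hf ω) := by
    rw [evTPt_tPt, serC_ltSMul, hs_def, ← ltSMul_ltAdd]
    rfl
  have key' : evT M s ((tPt M hA hf (ltSMul M hA hf a ω) : (seriesNilIdeal M).toIdeal) : PowerSeries S) =
      evT M (tPt M hA hf ω) ((hom hA hf hf a).map (algebraMap A S)) := by
    rw [← coe_evTPt, key]
    unfold ltSMul
    rw [coe_evalPt₁_eq_evalAt, evT_map]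
  have h1 := coeff_one_evT M s ((tPt M hA hf (ltSMul M hA hf a ω) : (seriesNilIdeal M).toIdeal) :
    PowerSeries S)
  rw [key', coeff_one_evT, ccPt_tPt', hs0, evS_zero_eq, PowerSeries.constantCoeff_derivative,
    coeff_one_tPt, coeff_one_tPt, hs1] at h1
  rw [h1, mul_comm]

/-- Evaluation at a point `t = ι g` coming from `g ∈ A⟦X⟧`, `g(0) = 0`, is algebraic substitution:
`h(t) = ι (h ∘ g)`. [cite: deShalit1987, Ch. I §3.5] -/
theorem evalAt_eq_map_subst (t : (seriesNilIdeal M).toIdeal) (g : PowerSeries A)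
    (hg : PowerSeries.constantCoeff g = 0) (ht : (t : PowerSeries S) = g.map (algebraMap A S))
    (h : PowerSeries A) :
    evalAt (seriesNilIdeal M) t h = PowerSeries.map (algebraMap A S) (h.subst g) := by
  rw [← evalAt_serX M (h.subst g), evalAt_apply, evalAt_apply, PowerSeries.aeval, PowerSeries.aeval,
    PowerSeries.subst_def]
  symm
  refine aeval_subst (PowerSeries.HasSubst.const (PowerSeries.HasSubst.of_constantCoeff_zero' hg)) _ h _
    fun _ => ?_
  rw [ht, ← evalAt_serX M g]
  rfl

/-! ### One level up: the series identities in `S⟦X⟧`, via the points `X` and `Y` of `S⟦X⟧⟦Y⟧` -/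

omit [UniformSpace A] [DiscreteUniformity A] [IsUniformAddGroup S] [IsTopologicalRing S]
  [IsLinearTopology S S] [T2Space S] [CompleteSpace S] [Algebra A S] [ContinuousSMul A S] in
/-- `G ↦ ι G`, `S⟦X⟧ → S⟦X⟧⟦Y⟧` (constants in `Y`) is continuous. [cite: deShalit1987, Ch. I §3.5] -/
theorem continuous_map_algebraMap_powerSeries :
    Continuous (fun G : PowerSeries S => G.map (algebraMap S (PowerSeries S))) := by
  refine continuous_pi fun d => ?_
  have e : (fun G : PowerSeries S => (G.map (algebraMap S (PowerSeries S))) d) =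
      fun G => algebraMap S (PowerSeries S) (G d) := by
    funext G
    exact MvPowerSeries.coeff_map (algebraMap S (PowerSeries S)) d G
  rw [e]
  exact (PowerSeries.WithPiTopology.continuous_C (R := S)).comp
    (continuous_apply (A := fun _ : (Unit →₀ ℕ) => S) d)

omit [UniformSpace A] [DiscreteUniformity A] [UniformSpace S] [IsUniformAddGroup S] [IsTopologicalRing S]
  [IsLinearTopology S S] [T2Space S] [CompleteSpace S] [ContinuousSMul A S] in
/-- `ι_{A → S⟦X⟧} = ι_{S → S⟦X⟧} ∘ ι_{A → S}` on series. [cite: deShalit1987, Ch. I §3.5] -/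
theorem map_algebraMap_powerSeries (g : PowerSeries A) :
    g.map (algebraMap A (PowerSeries S)) =
      (g.map (algebraMap A S)).map (algebraMap S (PowerSeries S)) := by
  ext n
  simp only [PowerSeries.coeff_map, IsScalarTower.algebraMap_apply A S (PowerSeries S)]

omit [UniformSpace A] [DiscreteUniformity A] [Algebra A S] [ContinuousSMul A S] in
/-- **Evaluating `Y ↦ X` undoes `ι`**: for `G ∈ S⟦X⟧`, `(ι G)(X) = G` in `S⟦X⟧` (the continuous
`S`-algebra map `G ↦ (ι G)(X)` fixes `X`). [cite: deShalit1987, Ch. I §3.5] -/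
theorem evS_serX_map_algebraMap (G : PowerSeries S) :
    evS (seriesNilIdeal M) (serX M) (G.map (algebraMap S (PowerSeries S))) = G := by
  -- (the ring map is assembled by hand: `S⟦X⟧⟦Y⟧` carries two `S⟦X⟧`-algebra structures in Mathlib)
  let ρ : PowerSeries S →+* PowerSeries S :=
    (evS (seriesNilIdeal M) (serX M) : PowerSeries (PowerSeries S) →+* PowerSeries S).comp
      (PowerSeries.map (algebraMap S (PowerSeries S)))
  have hρ : ∀ H : PowerSeries S,
      ρ H = evS (seriesNilIdeal M) (serX M) (H.map (algebraMap S (PowerSeries S))) := fun H => rfl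
  have hcomm : ∀ s : S, ρ (algebraMap S (PowerSeries S) s) = algebraMap S (PowerSeries S) s := by
    intro s
    rw [hρ, PowerSeries.algebraMap_eq, PowerSeries.map_C, evS_C]
  let ε : PowerSeries S →ₐ[S] PowerSeries S := ⟨ρ, hcomm⟩
  have happ : ∀ H : PowerSeries S,
      ε H = evS (seriesNilIdeal M) (serX M) (H.map (algebraMap S (PowerSeries S))) := fun H => rfl
  have hε : Continuous ε := by
    have : (ε : PowerSeries S → PowerSeries S) =
        (evS (seriesNilIdeal M) (serX M)) ∘ fun H : PowerSeries S =>
          H.map (algebraMap S (PowerSeries S)) := funext happ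
    rw [this]
    exact (continuous_evS (seriesNilIdeal M) (serX M)).comp continuous_map_algebraMap_powerSeries
  have hεX : ε PowerSeries.X = PowerSeries.X := by
    rw [happ, PowerSeries.map_X, evS_X, coe_serX]
  have hid : Continuous (AlgHom.id S (PowerSeries S)) := continuous_id
  have h1 := PowerSeries.aeval_unique hε
  have h2 := PowerSeries.aeval_unique hid
  have e : ε G = AlgHom.id S (PowerSeries S) G := by
    rw [← h1, ← h2]
    exact PowerSeries_aeval_congr _ _ (by change ε PowerSeries.X = PowerSeries.X; exact hεX) G
  rw [← happ, e, AlgHom.id_apply]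

/-- The point `Y [+] ι ω` of `S⟦X⟧⟦Y⟧` is `ι (X [+] ω)`. [cite: deShalit1987, Ch. I §3.5] -/
theorem coe_tPt_seriesNilIdeal_serC (ω : M.toIdeal) :
    ((tPt (seriesNilIdeal M) hA hf (serC M ω) : (seriesNilIdeal (seriesNilIdeal M)).toIdeal) :
        PowerSeries (PowerSeries S)) =
      ((tPt M hA hf ω : (seriesNilIdeal M).toIdeal) : PowerSeries S).map
        (algebraMap S (PowerSeries S)) := by
  let ε : PowerSeries S →ₐ[A] PowerSeries (PowerSeries S) :=
    PowerSeries.mapAlgHom (IsScalarTower.toAlgHom A S (PowerSeries S))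
  have happ : ∀ G : PowerSeries S, ε G = G.map (algebraMap S (PowerSeries S)) := fun G => rfl
  have hε : Continuous ε := by
    have : (ε : PowerSeries S → PowerSeries (PowerSeries S)) =
        fun G : PowerSeries S => G.map (algebraMap S (PowerSeries S)) := funext happ
    rw [this]
    exact continuous_map_algebraMap_powerSeries
  rw [← happ]
  symm
  change ε (evalPt (seriesNilIdeal M) (formalGroup hA hf).toPowerSeries
      (formalGroup hA hf).zero_constantCoeff ![serX M, serC M ω] : PowerSeries S) =
    (evalPt (seriesNilIdeal (seriesNilIdeal M)) (formalGroup hA hf).toPowerSeries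
      (formalGroup hA hf).zero_constantCoeff
      ![serX (seriesNilIdeal M), serC (seriesNilIdeal M) (serC M ω)] : PowerSeries (PowerSeries S))
  refine algHom_evalPt (seriesNilIdeal M) (seriesNilIdeal (seriesNilIdeal M)) ε hε _ _ _ _ fun i => ?_
  fin_cases i
  · change ε PowerSeries.X = PowerSeries.X
    rw [happ, PowerSeries.map_X]
  · change ε (PowerSeries.C (ω : S)) = PowerSeries.C (PowerSeries.C (ω : S))
    rw [happ, PowerSeries.map_C]
    rfl

/-- ★★ **Translation invariance of the invariant derivation**:
`ω_F(X [+] ω) = d⁄dX (X [+] ω) · ω_F(X)` in `S⟦X⟧`, for every point `ω` — equivalently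
`D(h(X [+] ω)) = (Dh)(X [+] ω)` for `D = ω_F · d⁄dX`.  (Proof: the point identity
`evalAt_ltAdd_invDiff` in the point algebra `S⟦X⟧` with `ω ↦ X`, `ω' ↦ C ω`.)
[cite: deShalit1987, Ch. I §3.5] -/
theorem transl_invDiff (ω : M.toIdeal) :
    transl M hA hf ω (invDiff hA hf) =
      PowerSeries.derivative S ((tPt M hA hf ω : (seriesNilIdeal M).toIdeal) : PowerSeries S) *
        (invDiff hA hf).map (algebraMap A S) := by
  have h := evalAt_ltAdd_invDiff (seriesNilIdeal M) hA hf (serX M) (serC M ω)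
  rw [evalAt_serX, coe_tPt_seriesNilIdeal_serC, PowerSeries.derivative_map,
    evS_serX_map_algebraMap] at h
  exact h

/-- **`d⁄dX h(X [+] ω)` through the invariant derivation**:
`ω_F · d⁄dX (h(X [+] ω)) = (ω_F · h')(X [+] ω)`. [cite: deShalit1987, Ch. I §3.5] -/
theorem invDiff_mul_derivative_transl (ω : M.toIdeal) (h : PowerSeries A) :
    (invDiff hA hf).map (algebraMap A S) * PowerSeries.derivative S (transl M hA hf ω h) =
      transl M hA hf ω (invDiff hA hf * PowerSeries.derivative A h) := by
  have e : transl M hA hf ω (invDiff hA hf * PowerSeries.derivative A h) =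
      transl M hA hf ω (invDiff hA hf) * transl M hA hf ω (PowerSeries.derivative A h) := by
    unfold transl
    exact map_mul _ _ _
  rw [e, transl_invDiff, derivative_transl]
  ring

variable (S) in
omit [UniformSpace A] [DiscreteUniformity A] [IsUniformAddGroup S] [IsTopologicalRing S]
  [IsLinearTopology S S] [CompleteSpace S] [Algebra A S] [ContinuousSMul A S] in
/-- The zero ideal as a nil ideal of points. [folklore] -/
def botNilIdeal : NilIdeal S where
  toIdeal := ⊥
  isClosed := by
    rw [Submodule.bot_coe]
    exact isClosed_singleton
  isTopologicallyNilpotent x hx := by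
    rw [(Submodule.mem_bot S).mp hx]
    exact IsTopologicallyNilpotent.zero

/-- ★★ **`[a]`-equivariance of the invariant derivation**: `ω_F · [a]' = a · ω_F ∘ [a]` (in `S⟦X⟧`;
over `A` itself when `A → S` is injective, `invDiff_mul_derivative_hom`); equivalently
`D(h ∘ [a]) = a · (Dh) ∘ [a]`.  For `a = π`: `ω_F · f' = π · ω_F ∘ f`. [cite: deShalit1987, Ch. I §3.5] -/
theorem map_invDiff_mul_derivative_hom (a : A) :
    PowerSeries.map (algebraMap A S) (invDiff hA hf * PowerSeries.derivative A (hom hA hf hf a)) =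
      PowerSeries.map (algebraMap A S) (PowerSeries.C a * (invDiff hA hf).subst (hom hA hf hf a)) := by
  have h := evalAt_ltSMul_invDiff (seriesNilIdeal (botNilIdeal S)) hA hf a (serX (botNilIdeal S))
  rw [evalAt_serX, evalAt_eq_map_subst (botNilIdeal S) _ (hom hA hf hf a) (constantCoeff_hom hA hf hf a)
      (coe_ltSMul_serX (botNilIdeal S) hA hf a), map_algebraMap_powerSeries,
    PowerSeries.derivative_map, evS_serX_map_algebraMap, PowerSeries.derivative_map,
    IsScalarTower.algebraMap_apply A S (PowerSeries S), PowerSeries.algebraMap_eq] at h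
  rw [map_mul, map_mul, PowerSeries.map_C, h, mul_comm]

/-- `ω_F · [a]' = a · ω_F ∘ [a]` in `A⟦X⟧`, when `A` embeds in some point algebra `S`.
[cite: deShalit1987, Ch. I §3.5] -/
theorem invDiff_mul_derivative_hom (hinj : Function.Injective (algebraMap A S)) (a : A) :
    invDiff hA hf * PowerSeries.derivative A (hom hA hf hf a) =
      PowerSeries.C a * (invDiff hA hf).subst (hom hA hf hf a) :=
  PowerSeries.map_injective (algebraMap A S) hinj (map_invDiff_mul_derivative_hom (S := S) hA hf a)

end Points

end LubinTate

end Literature.NumberTheory.GaloisRepresentations
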